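import Summits.RiemannHypothesis.RiemannHypothesis.Theorems.GapsEvoDoorsSincWitness
import Literature.NumberTheory.LFunctions.ZetaSpacingDensityRHProofs

/-!
# GapsEvoDoors — the sinc⁴ witness for `DeltaCIFinite`: the Fourier pair `r̂ = witnessHat`

Cell rh-gaps (D-0143/D-0145), engine EVO-TF-1 (eng-1 g2): the door-(a) SEARCH OBJECT of route
`GapsEvoDoors` (item stmt-RiemannHypothesis-22421 `DeltaCIFinite`) settled in the kernel by ONE
elementary test function of the engine's band-limited genus (BL: `r = (λ² − u²)·h²`, `ĥ` =
triangle), found by exact evaluation of the cell functional (work/numerics/bl_triangle_cert.py;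
cf. the certified witnesses of record (3/2, 1/20, 0.48381) eng-2 PW-SOS / (7/5, 1/20, 0.4999)
eng-1 HG, referee V-11/V-12/V-13, and the Fejér triangle (8, 1/20, 0.499), V-16 — none of which is
needed here). Window Δ = 2 (the fragment «F → 1 on 1 < |α| ≤ 2»), ε = 1/100, λ = 49/100; this
one-function family has λ*(Δ = 2) = √(15/(7π²)) = 0.46597 (float; engines' class optimum at Δ = 2
is 0.375). A pure real-analysis ∃-statement: no RH, no zeta; computed ≠ proved applies to every
engine number quoted, NOT to the theorems below; nothing here bears on the truth of RH.

Proved here: for `w ≠ 0` the explicit antiderivatives `antiA w`, `antiB w` of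
`pieceA·cos(w·)`, `pieceB·cos(w·)`; the boundary terms collect to
`(4cos w − 3 − cos 2w)(μ/w² − 1/w⁴) = −8 sin⁴(w/2)(μ/w² − 1/w⁴)`, which at `w = 2πu` is `r(u)/2`
(`μ(2πu)² = u²/λ²`); at `u = 0`, `∫ r̂ = 1 = r(0)`. Hence `∫ witnessHat(α) cos(2πuα) dα = r(u)`
for every `u` (`cosTransform_witnessHat`), and by Fourier inversion in the real even form
(`cosTransform_cosTransform`, from Mathlib's `Continuous.fourierInv_fourier_eq` and the tree's
`BGMM2023.fourier_ofReal_eq_cosTransform`) the cosine transform of the witness IS the closed form: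
`cosTransform witness = witnessHat`.
-/

noncomputable section

open Real MeasureTheory Set Filter Topology
open scoped FourierTransform
open Literature.NumberTheory.LFunctions Literature.NumberTheory.LFunctions.BGMM2023

set_option linter.dupNamespace false  -- the mandated namespace repeats `RiemannHypothesis`

namespace Summit.RiemannHypothesis.RiemannHypothesis.Theorems.GapsEvoDoorsSinc

/-! ## The Fourier pair `∫ r̂(α) cos(2πuα) dα = r(u)` -/

/-- `d/dx sin(wx) = w cos(wx)`. -/
theorem hasDerivAt_sin_mul (w x : ℝ) :
    HasDerivAt (fun x ↦ Real.sin (w * x)) (w * Real.cos (w * x)) x := by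
  have h := ((hasDerivAt_id x).const_mul w).sin
  simp only [id, mul_one] at h
  exact h.congr_deriv (by ring)

/-- `d/dx cos(wx) = −w sin(wx)`. -/
theorem hasDerivAt_cos_mul (w x : ℝ) :
    HasDerivAt (fun x ↦ Real.cos (w * x)) (-w * Real.sin (w * x)) x := by
  have h := ((hasDerivAt_id x).const_mul w).cos
  simp only [id, mul_one] at h
  exact h.congr_deriv (by ring)

/-- `antiA w` is an antiderivative of `pieceA · cos(w ·)`. -/
theorem hasDerivAt_antiA {w : ℝ} (hw : w ≠ 0) (x : ℝ) :
    HasDerivAt (antiA w) (pieceA x * Real.cos (w * x)) x := by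
  have hs := hasDerivAt_sin_mul w x
  have hc := hasDerivAt_cos_mul w x
  have hpA : HasDerivAt pieceA (-(2 - x) ^ 2 / 2 + 2 * (1 - x) ^ 2 + 3 * mu) x := by
    have h := (((((hasDerivAt_id' x).const_sub 2).fun_pow 3).div_const 6).fun_sub
      ((((hasDerivAt_id' x).const_sub 1).fun_pow 3).const_mul (2 / 3))).fun_add
      ((((hasDerivAt_id' x).const_mul 3).sub_const 2).const_mul mu)
    exact h.congr_deriv (by push_cast; ring)
  have hpA' : HasDerivAt (fun x ↦ -(2 - x) ^ 2 / 2 + 2 * (1 - x) ^ 2 + 3 * mu) (3 * x - 2) x := by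
    have h := (((((hasDerivAt_id' x).const_sub 2).fun_pow 2).fun_neg.div_const 2).fun_add
      ((((hasDerivAt_id' x).const_sub 1).fun_pow 2).const_mul 2)).add_const (3 * mu)
    exact h.congr_deriv (by push_cast; ring)
  have hpA'' : HasDerivAt (fun x : ℝ ↦ 3 * x - 2) 3 x := by
    have h := ((hasDerivAt_id' x).const_mul (3 : ℝ)).sub_const 2
    exact h.congr_deriv (by ring)
  have h := ((((hpA.fun_mul hs).div_const w).fun_add ((hpA'.fun_mul hc).div_const (w ^ 2))).fun_sub
    ((hpA''.fun_mul hs).div_const (w ^ 3))).fun_sub ((hc.const_mul 3).div_const (w ^ 4))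
  exact h.congr_deriv (by field_simp; ring)

/-- `antiB w` is an antiderivative of `pieceB · cos(w ·)`. -/
theorem hasDerivAt_antiB {w : ℝ} (hw : w ≠ 0) (x : ℝ) :
    HasDerivAt (antiB w) (pieceB x * Real.cos (w * x)) x := by
  have hs := hasDerivAt_sin_mul w x
  have hc := hasDerivAt_cos_mul w x
  have hpB : HasDerivAt pieceB (-(2 - x) ^ 2 / 2 - mu) x := by
    have h := ((((hasDerivAt_id' x).const_sub 2).fun_pow 3).div_const 6).fun_add
      (((hasDerivAt_id' x).const_sub 2).const_mul mu)
    exact h.congr_deriv (by push_cast; ring)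
  have hpB' : HasDerivAt (fun x ↦ -(2 - x) ^ 2 / 2 - mu) (2 - x) x := by
    have h := ((((hasDerivAt_id' x).const_sub 2).fun_pow 2).fun_neg.div_const 2).sub_const mu
    exact h.congr_deriv (by push_cast; ring)
  have hpB'' : HasDerivAt (fun x : ℝ ↦ 2 - x) (-1) x := by
    exact (hasDerivAt_id' x).const_sub 2
  have h := ((((hpB.fun_mul hs).div_const w).fun_add ((hpB'.fun_mul hc).div_const (w ^ 2))).fun_sub
    ((hpB''.fun_mul hs).div_const (w ^ 3))).fun_add (hc.div_const (w ^ 4))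
  exact h.congr_deriv (by field_simp; ring)

/-- `pieceA` is continuous. -/
theorem continuous_pieceA : Continuous pieceA := by unfold pieceA; fun_prop

/-- `pieceB` is continuous. -/
theorem continuous_pieceB : Continuous pieceB := by unfold pieceB; fun_prop

/-- `∫₀¹ pieceA(x) cos(wx) dx` by the antiderivative (`w ≠ 0`). -/
theorem integral_pieceA_cos {w : ℝ} (hw : w ≠ 0) :
    ∫ x in (0 : ℝ)..1, pieceA x * Real.cos (w * x) = antiA w 1 - antiA w 0 :=
  intervalIntegral.integral_eq_sub_of_hasDerivAt (fun x _ ↦ hasDerivAt_antiA hw x)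
    ((continuous_pieceA.mul (by fun_prop)).intervalIntegrable _ _)

/-- `∫₁² pieceB(x) cos(wx) dx` by the antiderivative (`w ≠ 0`). -/
theorem integral_pieceB_cos {w : ℝ} (hw : w ≠ 0) :
    ∫ x in (1 : ℝ)..2, pieceB x * Real.cos (w * x) = antiB w 2 - antiB w 1 :=
  intervalIntegral.integral_eq_sub_of_hasDerivAt (fun x _ ↦ hasDerivAt_antiB hw x)
    ((continuous_pieceB.mul (by fun_prop)).intervalIntegrable _ _)

/-- The boundary terms collect to `(4cos w − 3 − cos 2w)(μ/w² − 1/w⁴)`. -/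
theorem anti_sum {w : ℝ} (hw : w ≠ 0) :
    antiA w 1 - antiA w 0 + (antiB w 2 - antiB w 1) =
      (4 * Real.cos w - 3 - Real.cos (2 * w)) * (mu / w ^ 2 - 1 / w ^ 4) := by
  simp only [antiA, antiB, pieceA, pieceB, mul_one, mul_zero, Real.sin_zero, Real.cos_zero,
    mul_comm w 2]
  field_simp
  ring

/-- `4cos 2θ − 3 − cos 4θ = −8 sin⁴θ`. -/
theorem four_cos_sub_three_sub_cos (θ : ℝ) :
    4 * Real.cos (2 * θ) - 3 - Real.cos (2 * (2 * θ)) = -8 * Real.sin θ ^ 4 := by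
  have h1 : Real.cos (2 * θ) = 1 - 2 * Real.sin θ ^ 2 := by
    rw [Real.cos_two_mul, Real.cos_sq']; ring
  rw [Real.cos_two_mul (2 * θ), h1]
  ring

/-- For `u ≠ 0`, twice the collected boundary terms at `w = 2πu` is `r(u)`. -/
theorem witness_eq_two_mul {u : ℝ} (hu : u ≠ 0) :
    witness u = 2 * ((4 * Real.cos (2 * π * u) - 3 - Real.cos (2 * (2 * π * u))) *
      (mu / (2 * π * u) ^ 2 - 1 / (2 * π * u) ^ 4)) := by
  have hπu : π * u ≠ 0 := mul_ne_zero Real.pi_pos.ne' hu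
  rw [show 2 * π * u = 2 * (π * u) by ring, four_cos_sub_three_sub_cos]
  unfold witness
  rw [Real.sinc_of_ne_zero hπu, show u ^ 2 / lam ^ 2 = mu * (2 * π * u) ^ 2 from
    (mu_mul_sq u).symm]
  field_simp
  ring

/-- `primA' = pieceA`. -/
theorem hasDerivAt_primA (x : ℝ) : HasDerivAt primA (pieceA x) x := by
  have h := (((((hasDerivAt_id' x).const_sub 2).fun_pow 4).fun_neg.div_const 24).fun_add
    ((((hasDerivAt_id' x).const_sub 1).fun_pow 4).div_const 6)).fun_add
    (((((hasDerivAt_id' x).fun_pow 2).const_mul 3).div_const 2).fun_sub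
      ((hasDerivAt_id' x).const_mul 2) |>.const_mul mu)
  exact h.congr_deriv (by unfold pieceA; push_cast; ring)

/-- `primB' = pieceB`. -/
theorem hasDerivAt_primB (x : ℝ) : HasDerivAt primB (pieceB x) x := by
  have h := (((((hasDerivAt_id' x).const_sub 2).fun_pow 4).fun_neg.div_const 24).fun_sub
    (((((hasDerivAt_id' x).const_sub 2).fun_pow 2).const_mul mu).div_const 2))
  exact h.congr_deriv (by unfold pieceB; push_cast; ring)

/-- `∫₀¹ pieceA = 11/24 − μ/2`. -/
theorem integral_pieceA : ∫ x in (0 : ℝ)..1, pieceA x = 11 / 24 - mu / 2 := by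
  rw [intervalIntegral.integral_eq_sub_of_hasDerivAt (fun x _ ↦ hasDerivAt_primA x)
    (continuous_pieceA.intervalIntegrable _ _)]
  unfold primA
  ring

/-- `∫₁² pieceB = 1/24 + μ/2`. -/
theorem integral_pieceB : ∫ x in (1 : ℝ)..2, pieceB x = 1 / 24 + mu / 2 := by
  rw [intervalIntegral.integral_eq_sub_of_hasDerivAt (fun x _ ↦ hasDerivAt_primB x)
    (continuous_pieceB.intervalIntegrable _ _)]
  unfold primB
  ring

/-- **The Fourier pair**: `∫ r̂(α) cos(2πuα) dα = r(u)` for every `u`. -/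
theorem cosTransform_witnessHat (u : ℝ) : cosTransform witnessHat u = witness u := by
  unfold cosTransform
  set f : ℝ → ℝ := fun x ↦ witnessHat x * Real.cos (2 * π * u * x) with hfdef
  have hfc : Continuous f := by rw [hfdef]; exact witnessHat_continuous.mul (by fun_prop)
  have hfe : ∀ x, f (-x) = f x := fun x ↦ by
    simp only [hfdef, witnessHat_neg, mul_neg, Real.cos_neg]
  -- restrict to `[−2, 2]`
  have hvan : ∀ x ∉ Set.Icc (-2 : ℝ) 2, f x = 0 := by
    intro x hx
    rw [Set.mem_Icc, not_and_or, not_le, not_le] at hx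
    have h2 : 2 ≤ |x| := by
      rcases hx with h | h
      · rw [abs_of_neg (by linarith)]; linarith
      · rw [abs_of_pos (by linarith)]; linarith
    simp only [hfdef, witnessHat_eq_zero h2, zero_mul]
  rw [← setIntegral_eq_integral_of_forall_compl_eq_zero hvan, integral_Icc_eq_integral_Ioc,
    ← intervalIntegral.integral_of_le (by norm_num : (-2 : ℝ) ≤ 2),
    ← intervalIntegral.integral_add_adjacent_intervals (hfc.intervalIntegrable (-2) 0)
      (hfc.intervalIntegrable 0 2)]
  -- fold the negative half
  have hneg : ∫ x in (-2 : ℝ)..0, f x = ∫ x in (0 : ℝ)..2, f x := by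
    have h := intervalIntegral.integral_comp_neg (a := (0 : ℝ)) (b := 2) f
    rw [neg_zero] at h
    rw [← h]
    exact intervalIntegral.integral_congr fun x _ ↦ hfe x
  rw [hneg, ← intervalIntegral.integral_add_adjacent_intervals (hfc.intervalIntegrable 0 1)
      (hfc.intervalIntegrable 1 2)]
  -- the two pieces
  have hA : ∫ x in (0 : ℝ)..1, f x = ∫ x in (0 : ℝ)..1, pieceA x * Real.cos (2 * π * u * x) := by
    refine intervalIntegral.integral_congr fun x hx ↦ ?_
    rw [Set.uIcc_of_le zero_le_one] at hx
    simp only [hfdef, witnessHat_eq_pieceA hx.1 hx.2]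
  have hB : ∫ x in (1 : ℝ)..2, f x = ∫ x in (1 : ℝ)..2, pieceB x * Real.cos (2 * π * u * x) := by
    refine intervalIntegral.integral_congr fun x hx ↦ ?_
    rw [Set.uIcc_of_le one_le_two] at hx
    simp only [hfdef, witnessHat_eq_pieceB hx.1 hx.2]
  rw [hA, hB]
  rcases eq_or_ne u 0 with hu | hu
  · -- `u = 0`: `∫ r̂ = 1 = r(0)`
    subst hu
    simp only [mul_zero, zero_mul, Real.cos_zero, mul_one, witness_zero]
    rw [integral_pieceA, integral_pieceB]
    ring
  · have hw : 2 * π * u ≠ 0 := mul_ne_zero (mul_ne_zero two_ne_zero Real.pi_pos.ne') hu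
    rw [integral_pieceA_cos hw, integral_pieceB_cos hw, witness_eq_two_mul hu, ← anti_sum hw]
    ring

/-- **Fourier inversion, real even form**: for `g` even, continuous, integrable with `ĝ ∈ L¹`,
the cosine transform of `ĝ` is `g`. -/
theorem cosTransform_cosTransform {g : ℝ → ℝ} (hc : Continuous g) (hi : Integrable g)
    (heven : ∀ x, g (-x) = g x) (hti : Integrable (cosTransform g)) (x : ℝ) :
    cosTransform (cosTransform g) x = g x := by
  set f : ℝ → ℂ := fun u ↦ (g u : ℂ) with hfdef
  have hf : Integrable f := hi.ofReal
  have hfc : Continuous f := Complex.continuous_ofReal.comp hc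
  have hF : 𝓕 f = fun ξ ↦ (cosTransform g ξ : ℂ) := funext (fourier_ofReal_eq_cosTransform heven hi)
  have hFi : Integrable (𝓕 f) := by rw [hF]; exact hti.ofReal
  have hinv := hfc.fourierInv_fourier_eq hf hFi
  rw [hF] at hinv
  have h1 : 𝓕⁻ (fun ξ : ℝ ↦ (cosTransform g ξ : ℂ)) (-x) = f (-x) := by rw [hinv]
  rw [Real.fourierInv_eq_fourier_neg, neg_neg,
    fourier_ofReal_eq_cosTransform (cosTransform_neg g) hti x] at h1
  have h2 : f (-x) = (g x : ℂ) := by simp only [hfdef, heven]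
  rw [h2] at h1
  exact_mod_cast h1

/-- **`r̂ = witnessHat`**: the cosine transform of the witness is the closed form. -/
theorem cosTransform_witness : cosTransform witness = witnessHat := by
  have hT : cosTransform witnessHat = witness := funext cosTransform_witnessHat
  have hti : Integrable (cosTransform witnessHat) := by rw [hT]; exact witness_integrable
  funext a
  rw [← hT]
  exact cosTransform_cosTransform witnessHat_continuous witnessHat_integrable witnessHat_neg hti a

end Summit.RiemannHypothesis.RiemannHypothesis.Theorems.GapsEvoDoorsSinc

end
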